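import Summits.QuantumFields.QCD.Theses.NestedDissectionSea
import Summits.QuantumFields.QCD.Theorems.NestedDissectionSeaKineticEdgePath
import Summits.QuantumFields.QCD.Theorems.NestedDissectionSeaKineticEdgeDiamagnetic

/-!
# Route `NestedDissectionSea`, support item `KineticEdge` (stmt-QuantumFields-13899) — 3/3:
# the kinetic edge of Dirichlet Wilson cells

`kineticEdge_proof : Summit.QuantumFields.QCD.Theses.NestedDissectionSea.KineticEdge`.

For an `SU(3)` gauge field `U` on the four-torus `(ℤ/N)⁴`, a corner `x` and sides `s` with
`s_i ≤ N`, let `D_c = wilsonCell U m x s` be the Dirichlet cell matrix (principal submatrix of the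
`r = 1` Wilson–Dirac matrix on the open box) and `e(s) = Σ_i (1 − cos(π / s_i))` the free Dirichlet
kinetic edge of the box.

* `re_quadForm_wilsonDirac_ge_box` — NUMERICAL RANGE: for every field `v` supported in the box,
  `(m + 4 − Σ_μ cos(π/s_μ)) ‖v‖² ≤ Re ⟨v, D_W(U, m, 1) v⟩`.  Ingredients: the tree's
  `D_W = (m+4)·1 − Σ_μ W_μ` (`wilsonDirac_eq_sub_sum_wilsonHop`); the Hermitian part of `W_μ` is the
  spin-blind covariant hop and the lattice diamagnetic inequality bounds `Re⟨v, W_μ v⟩` by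
  `Σ_y |v|(y) |v|(y+μ̂)` (helper 2/3, `re_inner_wilsonHop_le`); the Dirichlet path-graph bound
  `Σ_y g(y)g(y+μ̂) ≤ cos(π/s_μ) Σ_y g(y)²` for `g = |v|` supported in the site box (helper 1/3,
  `sum_mul_shift_le_cos_mul_sum_sq`).
* (a) `kineticEdge_zeroMode` — a ZERO MODE `det D_c = 0` at bare mass `μ'` forces `e(s) ≤ −μ'`
  (kernel vector extended by zero: `Re⟨v, D_W v⟩ = 0`).
* (b) `kineticEdge_separator` — a `τ`-SINGULAR SEPARATOR (`HasSingularSeparator U μ s τ`, `τ ≥ 0`)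
  forces `e(s) < τ − μ` (harmonic extension `w`: `Re⟨w, D_c w⟩ ≤ ‖w‖ ‖D_c w‖ < τ ‖w‖²`).

Sources: Montvay–Münster 1994 §4.2 (Wilson term); Brydges–Fröhlich–Seiler 1979 §2 (diamagnetic
inequality); Brouwer–Haemers §1.4.4 (path spectrum); the cell vocabulary is the tree's
`WilsonCellSchur`.  No named facts: the result is unconditional.
-/

noncomputable section

open Matrix
open scoped ComplexConjugate
open Literature.MathematicalPhysics Literature.MathematicalPhysics.QuantumLattice
  Literature.MathematicalPhysics.QuantumFieldTheory Literature.Probability.LatticeModels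

namespace Summit.QuantumFields.QCD.Theorems.KineticEdge

/-! ### Numerical range of the Wilson–Dirac matrix on fields supported in a box -/

section Torus

variable {L N : ℕ} [NeZero L] {G : Type*} [Group G] (ρ : G →* Matrix (Fin N) (Fin N) ℂ)

/-- **Hopping bound in a box**: for unitary `ρ`, a field `v` supported in the open box of corner
`x` and sides `s`, and a direction `μ` with `s_μ ≤ L`,
`Re Σ_i conj(v i) (W_μ v)_i ≤ cos(π/s_μ) Σ_i ‖v i‖²` (diamagnetic inequality + path-graph bound). -/
theorem re_inner_wilsonHop_le_cos (hρ : ∀ g, ρ g ∈ Matrix.unitaryGroup (Fin N) ℂ)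
    (U : GaugeConfig 4 L G) (x : TorusSite 4 L) (s : Fin 4 → ℕ) (μ : Fin 4) (hs : s μ ≤ L)
    (v : TorusSite 4 L × Fin N × Fin 4 → ℂ) (hv : ∀ i, ¬ siteBox x s i.1 → v i = 0) :
    (∑ i, conj (v i) * (wilsonHop ρ U μ *ᵥ v) i).re ≤
      Real.cos (Real.pi / s μ) * ∑ i, ‖v i‖ ^ 2 := by
  set g : TorusSite 4 L → ℝ := fun y => Real.sqrt (∑ a, ∑ α, ‖v (y, a, α)‖ ^ 2) with hg
  have hg0 : ∀ y, ¬ siteBox x s y → g y = 0 := by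
    intro y hy
    have h0 : ∀ a α, v (y, a, α) = 0 := fun a α => hv (y, a, α) hy
    simp [hg, h0]
  have h1 := re_inner_wilsonHop_le ρ hρ U μ v
  have h2 := sum_mul_shift_le_cos_mul_sum_sq x s μ hs g hg0
  have h3 : ∑ y, g y ^ 2 = ∑ i, ‖v i‖ ^ 2 := by
    rw [Fintype.sum_prod_type]
    refine Finset.sum_congr rfl fun y _ => ?_
    rw [hg, Real.sq_sqrt (Finset.sum_nonneg fun a _ => Finset.sum_nonneg fun α _ => by positivity),
      Fintype.sum_prod_type]
  rw [← h3]
  exact h1.trans h2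

/-- **Numerical range of the Wilson–Dirac matrix on a Dirichlet box.** For unitary `ρ`, every gauge
field, every real bare mass `m`, and every field `v` supported in the open box of corner `x` and
sides `s ≤ L`: `(m + 4 − Σ_μ cos(π/s_μ)) Σ_i ‖v i‖² ≤ Re Σ_i conj(v i) (D_W(U,m,1) v)_i`.
The sharp (box-size dependent) form of the tree's `re_quadForm_wilsonDirac_ge` (edge `m`). -/
theorem re_quadForm_wilsonDirac_ge_box (hρ : ∀ g, ρ g ∈ Matrix.unitaryGroup (Fin N) ℂ)
    (U : GaugeConfig 4 L G) (m : ℝ) (x : TorusSite 4 L) (s : Fin 4 → ℕ) (hs : ∀ i, s i ≤ L)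
    (v : TorusSite 4 L × Fin N × Fin 4 → ℂ) (hv : ∀ i, ¬ siteBox x s i.1 → v i = 0) :
    (m + 4 - ∑ μ, Real.cos (Real.pi / s μ)) * ∑ i, ‖v i‖ ^ 2 ≤
      (∑ i, conj (v i) * (wilsonDirac ρ U m 1 *ᵥ v) i).re := by
  rw [wilsonDirac_eq_sub_sum_wilsonHop ρ hρ U m, Matrix.sub_mulVec, Matrix.smul_mulVec,
    Matrix.one_mulVec, Matrix.sum_mulVec]
  have hdiag : (∑ i, conj (v i) * ((((m + 4 : ℝ) : ℂ) • v) i)).re = (m + 4) * ∑ i, ‖v i‖ ^ 2 := by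
    rw [Complex.re_sum, Finset.mul_sum]
    refine Finset.sum_congr rfl fun i _ => ?_
    rw [Pi.smul_apply, smul_eq_mul, mul_left_comm, Complex.re_ofReal_mul, Complex.conj_mul',
      ← Complex.ofReal_pow, Complex.ofReal_re]
  have hsum : ∀ μ : Fin 4, (∑ i, conj (v i) * (wilsonHop ρ U μ *ᵥ v) i).re ≤
      Real.cos (Real.pi / s μ) * ∑ i, ‖v i‖ ^ 2 :=
    fun μ => re_inner_wilsonHop_le_cos ρ hρ U x s μ (hs μ) v hv
  have hexp : (∑ i, conj (v i) * ((((m + 4 : ℝ) : ℂ) • v) - ∑ μ, wilsonHop ρ U μ *ᵥ v) i) =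
      (∑ i, conj (v i) * ((((m + 4 : ℝ) : ℂ) • v) i)) -
        ∑ μ, ∑ i, conj (v i) * (wilsonHop ρ U μ *ᵥ v) i := by
    rw [Finset.sum_comm, ← Finset.sum_sub_distrib]
    refine Finset.sum_congr rfl fun i _ => ?_
    rw [Pi.sub_apply, Finset.sum_apply, mul_sub, Finset.mul_sum]
  rw [hexp, Complex.sub_re, hdiag, Complex.re_sum]
  have h4 : ∑ μ : Fin 4, (∑ i, conj (v i) * (wilsonHop ρ U μ *ᵥ v) i).re ≤
      ∑ μ : Fin 4, Real.cos (Real.pi / s μ) * ∑ i, ‖v i‖ ^ 2 := Finset.sum_le_sum fun μ _ => hsum μ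
  rw [← Finset.sum_mul] at h4
  rw [sub_mul]
  linarith

end Torus

/-! ### The kinetic edge of Dirichlet cells (`SU(3)`, `r = 1`) -/

section Cell

variable {N : ℕ} [NeZero N]

/-- Local shorthand: the colour group `SU(3)`. -/
local notation "𝔾" => Matrix.specialUnitaryGroup (Fin 3) ℂ

/-- `Σ_i (1 − cos(π/s_i)) = 4 − Σ_i cos(π/s_i)` over the four directions. -/
theorem sum_one_sub_cos (s : Fin 4 → ℕ) :
    ∑ i, (1 - Real.cos (Real.pi / s i)) = 4 - ∑ i, Real.cos (Real.pi / s i) := by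
  rw [Finset.sum_sub_distrib]
  simp

/-- Sums of a `dite`-extension over the ambient type reduce to the subtype (any `Fintype` structure
on the subtype). -/
theorem sum_dite_subtype {ι M : Type*} [Fintype ι] [AddCommMonoid M] (p : ι → Prop) [DecidablePred p]
    {instp : Fintype {a // p a}} (F : {a // p a} → M) :
    ∑ i, (if h : p i then F ⟨i, h⟩ else 0) = ∑ a, F a := by
  calc ∑ i, (if h : p i then F ⟨i, h⟩ else 0)
        = ∑ i ∈ Finset.univ.filter p, (if h : p i then F ⟨i, h⟩ else 0) := by
          rw [Finset.sum_filter]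
          refine Finset.sum_congr rfl fun i _ => ?_
          by_cases hi : p i
          · rw [if_pos hi]
          · rw [if_neg hi, dif_neg hi]
    _ = ∑ a : {a // p a}, (if h : p (a : ι) then F ⟨a, h⟩ else 0) :=
          Finset.sum_subtype _ (fun i => by simp) _
    _ = ∑ a, F a := Finset.sum_congr rfl fun a _ => by rw [dif_pos a.2]

/-- **Numerical range of a Dirichlet cell** (zero-extension form): for a vector `w` on the open box
of corner `x` and sides `s ≤ N`, extended by zero to `v`, the cell form equals the torus form and
`(m + 4 − Σ cos(π/s_i)) Σ_a ‖w a‖² ≤ Re Σ_a conj(w a) (D_c w)_a`.  Instance-polymorphic in the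
`Fintype` structure of the box subtype, so that it applies to the route's `wilsonCell` under any
elaboration of the index instances. -/
theorem re_quadForm_wilsonCell_ge (U : GaugeConfig 4 N 𝔾) (m : ℝ) (x : TorusSite 4 N)
    (s : Fin 4 → ℕ) (hs : ∀ i, s i ≤ N) [Fintype {a // wilsonBox x s a}]
    (w : {a // wilsonBox x s a} → ℂ) :
    (m + 4 - ∑ μ, Real.cos (Real.pi / s μ)) * ∑ a, ‖w a‖ ^ 2 ≤
      (∑ a, conj (w a) * (wilsonCell U m x s *ᵥ w) a).re := by
  classical
  set D := wilsonDirac (fundamentalRep (Fin 3)) U m 1 with hD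
  set v : TorusSite 4 N × Fin 3 × Fin 4 → ℂ := fun i => if h : wilsonBox x s i then w ⟨i, h⟩ else 0
    with hv
  have hvp : ∀ i : {a // wilsonBox x s a}, v i = w i := fun i => by simp [hv, i.2]
  have hvn : ∀ i, ¬ wilsonBox x s i → v i = 0 := fun i hi => by simp [hv, hi]
  -- the cell acts on `w` as `D_W` acts on the zero extension
  have hDv : ∀ i : {a // wilsonBox x s a}, (D *ᵥ v) i = (wilsonCell U m x s *ᵥ w) i := by
    intro i
    simp only [Matrix.mulVec, dotProduct, wilsonCell, Matrix.toSquareBlockProp_def, Matrix.of_apply]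
    have hR : (∑ j : {a // wilsonBox x s a}, D (i : TorusSite 4 N × Fin 3 × Fin 4) j * w j) =
        ∑ j ∈ Finset.univ.filter (wilsonBox x s), D (i : TorusSite 4 N × Fin 3 × Fin 4) j * v j := by
      rw [Finset.sum_subtype (Finset.univ.filter (wilsonBox x s)) (p := wilsonBox x s)
        (fun j => by simp)]
      exact Finset.sum_congr rfl fun j _ => by rw [hvp j]
    rw [hR, Finset.sum_filter]
    refine Finset.sum_congr rfl fun j _ => ?_
    by_cases hj : wilsonBox x s j
    · simp [hj]
    · simp [hj, hvn j hj]
  -- the two quadratic forms and the two norms agree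
  have hquad : (∑ i, conj (v i) * (D *ᵥ v) i) = ∑ a, conj (w a) * (wilsonCell U m x s *ᵥ w) a := by
    have : ∀ i, conj (v i) * (D *ᵥ v) i =
        if h : wilsonBox x s i then conj (w ⟨i, h⟩) * (wilsonCell U m x s *ᵥ w) ⟨i, h⟩ else 0 := by
      intro i
      by_cases hi : wilsonBox x s i
      · rw [dif_pos hi, ← hDv ⟨i, hi⟩, hvp ⟨i, hi⟩]
      · rw [dif_neg hi, hvn i hi, map_zero, zero_mul]
    simp_rw [this]
    exact sum_dite_subtype (wilsonBox x s) (fun a => conj (w a) * (wilsonCell U m x s *ᵥ w) a)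
  have hnorm : ∑ i, ‖v i‖ ^ 2 = ∑ a, ‖w a‖ ^ 2 := by
    have : ∀ i, ‖v i‖ ^ 2 = if h : wilsonBox x s i then ‖w ⟨i, h⟩‖ ^ 2 else 0 := by
      intro i
      by_cases hi : wilsonBox x s i
      · rw [dif_pos hi, ← hvp ⟨i, hi⟩]
      · rw [dif_neg hi, hvn i hi]; simp
    simp_rw [this]
    exact sum_dite_subtype (wilsonBox x s) (fun a => ‖w a‖ ^ 2)
  have hvs : ∀ i : TorusSite 4 N × Fin 3 × Fin 4, ¬ siteBox x s i.1 → v i = 0 :=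
    fun i hi => hvn i hi
  have key := re_quadForm_wilsonDirac_ge_box (fundamentalRep (Fin 3)) fundamentalRep_mem_unitaryGroup
    U m x s hs v hvs
  rwa [hquad, hnorm] at key

/-- **(a) Kinetic edge of a zero mode.** If the Dirichlet cell of corner `x` and sides `s ≤ N` is
singular at bare mass `μ'`, then `Σ_i (1 − cos(π/s_i)) ≤ −μ'`: a kernel vector `w ≠ 0` has
`Re⟨w, D_c w⟩ = 0 ≥ (μ' + 4 − Σ cos(π/s_i)) ‖w‖²`. -/
theorem kineticEdge_zeroMode (U : GaugeConfig 4 N 𝔾) (s : Fin 4 → ℕ) (μ' : ℝ) (x : TorusSite 4 N)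
    (hs : ∀ i, s i ≤ N) [Fintype {a // wilsonBox x s a}] [DecidableEq {a // wilsonBox x s a}]
    (hdet : (wilsonCell U μ' x s).det = 0) :
    ∑ i, (1 - Real.cos (Real.pi / s i)) ≤ -μ' := by
  obtain ⟨w, hw0, hw⟩ := Matrix.exists_mulVec_eq_zero_iff.mpr hdet
  have key := re_quadForm_wilsonCell_ge U μ' x s hs w
  rw [hw] at key
  simp only [Pi.zero_apply, mul_zero, Finset.sum_const_zero, Complex.zero_re] at key
  have hS : 0 < ∑ a, ‖w a‖ ^ 2 := by
    obtain ⟨a, ha⟩ : ∃ a, w a ≠ 0 := by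
      by_contra h
      push Not at h
      exact hw0 (funext h)
    have hpos : 0 < ‖w a‖ ^ 2 := by positivity
    exact lt_of_lt_of_le hpos
      (Finset.single_le_sum (f := fun b => ‖w b‖ ^ 2) (fun b _ => by positivity) (Finset.mem_univ a))
  have hle : μ' + 4 - ∑ μ, Real.cos (Real.pi / s μ) ≤ 0 := by
    by_contra h
    push Not at h
    have := mul_pos h hS
    linarith
  rw [sum_one_sub_cos]
  linarith

/-- **(b) Kinetic edge of a near-singular separator.** If the corner-`0` box of sides `s ≤ N` has a
`τ`-singular separator at bare mass `μ` with `τ ≥ 0`, then `Σ_i (1 − cos(π/s_i)) < τ − μ`: the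
harmonic extension `w` has full residual equal to its separator residual, so
`(μ + 4 − Σ cos) ‖w‖² ≤ Re⟨w, D_c w⟩ ≤ ‖w‖ ‖D_c w‖ < τ ‖w‖²`. -/
theorem kineticEdge_separator (U : GaugeConfig 4 N 𝔾) (s : Fin 4 → ℕ) (μ τ : ℝ) (hτ : 0 ≤ τ)
    (hs : ∀ i, s i ≤ N) (h : HasSingularSeparator U μ s τ) :
    ∑ i, (1 - Real.cos (Real.pi / s i)) < τ - μ := by
  obtain ⟨w, ⟨p₀, -, hw₀⟩, hharm, hres⟩ := h
  set Dc := wilsonCell U μ 0 s with hDc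
  set n2 := ∑ p, ‖w p‖ ^ 2 with hn2
  have hn2_pos : 0 < n2 := by
    have hw₀' : 0 < ‖w p₀‖ := norm_pos_iff.mpr hw₀
    exact Finset.sum_pos' (fun p _ => by positivity) ⟨p₀, Finset.mem_univ _, by positivity⟩
  have hRfull : ∑ p, ‖(Dc *ᵥ w) p‖ ^ 2 =
      ∑ p, (if childrenInterior s p then 0 else ‖(Dc *ᵥ w) p‖ ^ 2) := by
    refine Finset.sum_congr rfl fun p _ => ?_
    split_ifs with hp
    · rw [hharm p hp]; simp
    · rfl
  have hsep_le : ∑ p, (if childrenInterior s p then 0 else ‖w p‖ ^ 2) ≤ n2 :=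
    Finset.sum_le_sum fun p _ => by
      split_ifs
      · positivity
      · exact le_rfl
  have hR2 : ∑ p, ‖(Dc *ᵥ w) p‖ ^ 2 < τ ^ 2 * n2 := by
    rw [hRfull]; exact hres.trans_le (mul_le_mul_of_nonneg_left hsep_le (sq_nonneg τ))
  have hco := re_quadForm_wilsonCell_ge U μ 0 s hs w
  change (μ + 4 - ∑ ν, Real.cos (Real.pi / s ν)) * n2 ≤ (∑ p, conj (w p) * (Dc *ᵥ w) p).re at hco
  set A := ∑ p, ‖w p‖ * ‖(Dc *ᵥ w) p‖ with hA
  have hA1 : (∑ p, conj (w p) * (Dc *ᵥ w) p).re ≤ A := by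
    refine (Complex.re_le_norm _).trans ((norm_sum_le _ _).trans (le_of_eq ?_))
    simp [A]
  have hA0 : 0 ≤ A := Finset.sum_nonneg fun p _ => by positivity
  have hA2 : A ^ 2 ≤ n2 * ∑ p, ‖(Dc *ᵥ w) p‖ ^ 2 := Finset.sum_mul_sq_le_sq_mul_sq _ _ _
  -- `A < τ n2`
  have hA3 : A ^ 2 < (τ * n2) ^ 2 := by
    calc A ^ 2 ≤ n2 * ∑ p, ‖(Dc *ᵥ w) p‖ ^ 2 := hA2
      _ < n2 * (τ ^ 2 * n2) := mul_lt_mul_of_pos_left hR2 hn2_pos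
      _ = (τ * n2) ^ 2 := by ring
  have hA4 : A < τ * n2 := by
    have hτn : 0 ≤ τ * n2 := mul_nonneg hτ hn2_pos.le
    nlinarith
  have hlt : (μ + 4 - ∑ ν, Real.cos (Real.pi / s ν)) * n2 < τ * n2 :=
    lt_of_le_of_lt (hco.trans hA1) hA4
  have hμ : μ + 4 - ∑ ν, Real.cos (Real.pi / s ν) < τ := lt_of_mul_lt_mul_right hlt hn2_pos.le
  rw [sum_one_sub_cos]
  linarith

end Cell

end Summit.QuantumFields.QCD.Theorems.KineticEdge

/-! ### The route item -/

namespace Summit.QuantumFields.QCD.Theorems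

open Summit.QuantumFields.QCD.Theorems.KineticEdge

/-- **Kinetic edge of Dirichlet Wilson cells** — route support item `KineticEdge`
(stmt-QuantumFields-13899) of `NestedDissectionSea`, proved unconditionally: for every `SU(3)`
gauge field on `(ℤ/N)⁴` and sides `s ≤ N`, (a) a zero mode of the Dirichlet cell at bare mass `μ'`
forces `Σ_i (1 − cos(π/s_i)) ≤ −μ'`, and (b) a `τ`-singular separator at bare mass `μ` (`τ ≥ 0`)
forces `Σ_i (1 − cos(π/s_i)) < τ − μ`. -/
theorem kineticEdge_proof : Summit.QuantumFields.QCD.Theses.NestedDissectionSea.KineticEdge := by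
  intro N _ U s
  exact ⟨fun μ' x hs hdet => kineticEdge_zeroMode U s μ' x hs hdet,
    fun μ τ hτ hs h => kineticEdge_separator U s μ τ hτ hs h⟩

end Summit.QuantumFields.QCD.Theorems

end
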